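import Literature.Computability.AlgebraicComplexity.ArithCircuitProofs
import HarnessLib

/-!
# TwoAdicLadder — crux `TwoIntegralNormalisation` (stmt-ValiantsHypothesis-5947), line `birth`,
# stub `stub_halfElim`: CLEARING DENOMINATORS IN A STRAIGHT-LINE PROGRAM COSTS NOTHING UP TO A SCALAR

Route `ValiantsHypothesis/TwoAdicLadder`, crux `TwoIntegralNormalisation`, registered line
`Cruxes/TwoIntegralNormalisation/Lines/birth.lean`, load-bearing stub `stub_halfElim` (elimination
of division by `2` for the permanent at polynomial cost — open). This file proves the general,
hypothesis-free half of that elimination: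

**Denominator clearing.** Let `ι : S →+* K` be a ring homomorphism and `t ∈ S` an element such that
every constant `c ∈ K` becomes `S`-rational after multiplication by a power of `ι t`
(`ι (num c) = ι t ^ N c * c`). Then every fan-in-two circuit `P` over `K` has a companion circuit
`clear P` over `S` OF THE SAME SHAPE AND SIZE computing `t ^ M · P.eval` for an explicit exponent
`M = clearExp P` (`map_eval_clear`, `size_clear`, `IsFanInTwo.clear`): gate by gate, a product gate
multiplies the exponents' sum, a weighted-sum gate is brought to the common exponent
`M = Σᵢ (N cᵢ + mᵢ)` by multiplying its coefficients with powers of `t` — ring operations of `S`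
only, no new gates. Consequently (`exists_complexity_C_pow_mul_le`), for `ι` injective,
`∃ M, L_S(t^M · f) ≤ L_K(f ⊗ K)` for every `f ∈ S[X]`.

Applied to `S = 𝓞_(𝔭) ⊂ K` (number field, `𝔭 ∣ 2`, `t = 2`; file
`TwoAdicLadderTwoIntegralNormalisationScaledHalfElim.lean`) this is the `2`-adic analogue of
"approximative ⇒ exact up to `ε^M`": all divisions by `2` of a number-field circuit for `per_n`
can be postponed to ONE exact division by `2^M` at the output, at no cost in size. The open content
of `stub_halfElim` is exactly that last division. Honest framing: `stub_halfElim`, the crux and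
VP ≠ VNP are NOT proved here.
-/

noncomputable section

open MvPolynomial

-- the summit and the problem share the name `ValiantsHypothesis` (D-0017 single-conjunct layout)
set_option linter.dupNamespace false

namespace Summit.ValiantsHypothesis.ValiantsHypothesis.Theorems.TwoAdicLadder.TwoIntegralNormalisation

open Literature.Computability.AlgebraicComplexity ArithCircuit

universe u v w

section Clearing

variable {S : Type u} {K : Type v} {σ : Type w}

/-! ### The gate-local transformation -/

section Defs

variable (num : K → S) (N : K → ℕ) (t : S)

/-- The `t`-exponent of an operand, given the exponents `E` of the gates computed so far:
variables `0`, a constant `c` its denominator exponent `N c`, a gate reference its recorded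
exponent (junk references read `0`). [folklore] -/
def opExp (E : List ℕ) : Operand K σ → ℕ
  | .var _ => 0
  | .const c => N c
  | .gate j => E.getD j 0

/-- The cleared operand: a constant `c` is replaced by its numerator `num c`. [folklore] -/
def opClear : Operand K σ → Operand S σ
  | .var i => .var i
  | .const c => .const (num c)
  | .gate j => .gate j

/-- The `t`-exponent of a gate: for a product the sum of the operands' exponents, for a weighted
sum `Σ cᵢ • uᵢ` the common exponent `Σᵢ (N cᵢ + exp uᵢ)`. [folklore] -/
def gateExp (E : List ℕ) : Gate K σ → ℕ
  | .sum args => (args.map fun a => N a.1 + opExp N E a.2).sum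
  | .prod args => (args.map (opExp N E)).sum

variable [Monoid S]

/-- The cleared gate: operands cleared; in a weighted sum the coefficient `cᵢ` becomes
`t ^ (M - (N cᵢ + exp uᵢ)) * num cᵢ`, `M` the common exponent `gateExp`. Same fan-in. [folklore] -/
def gateClear (E : List ℕ) : Gate K σ → Gate S σ
  | .sum args => .sum (args.map fun a =>
      (t ^ ((args.map fun a => N a.1 + opExp N E a.2).sum - (N a.1 + opExp N E a.2)) * num a.1,
        opClear num a.2))
  | .prod args => .prod (args.map (opClear num))

/-- Clearing a gate list: the cleared gates together with the list of their exponents (a left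
fold, each gate processed against the exponents of the gates before it). [folklore] -/
def clearAux (gs : List (Gate K σ)) : List (Gate S σ) × List ℕ :=
  gs.foldl (fun acc g => (acc.1 ++ [gateClear num N t acc.2 g], acc.2 ++ [gateExp N acc.2 g]))
    ([], [])

/-- The cleared circuit `clear P` over `S` (same gates up to constants, same output operand up to
its constant). [folklore] -/
def clear (P : ArithCircuit K σ) : ArithCircuit S σ where
  gates := (clearAux num N t P.gates).1
  output := opClear num P.output

/-- The exponent `M` with `clear P` computing `t ^ M · P.eval`. [folklore] -/
def clearExp (P : ArithCircuit K σ) : ℕ :=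
  opExp N (clearAux num N t P.gates).2 P.output

end Defs

/-! ### `getD` on a list extended by one entry -/

section GetD

variable {α : Type*}

/-- `getD` below the old length of a list extended by one entry. [folklore] -/
theorem getD_concat_of_lt (l : List α) (a d : α) {j : ℕ} (hj : j < l.length) :
    (l ++ [a]).getD j d = l.getD j d := by
  rw [List.getD_eq_getElem?_getD, List.getD_eq_getElem?_getD, List.getElem?_append_left hj]

/-- `getD` at the old length of a list extended by one entry. [folklore] -/
theorem getD_concat_length (l : List α) (a d : α) : (l ++ [a]).getD l.length d = a := by
  rw [List.getD_eq_getElem?_getD, List.getElem?_concat_length]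
  rfl

/-- `getD` at the old length of a list extended by one entry (index given up to an equation).
[folklore] -/
theorem getD_concat_of_eq (l : List α) (a d : α) {j : ℕ} (hj : j = l.length) :
    (l ++ [a]).getD j d = a := by
  subst hj
  exact getD_concat_length l a d

/-- `getD` beyond the length reads the default. [folklore] -/
theorem getD_of_length_le (l : List α) (d : α) {j : ℕ} (hj : l.length ≤ j) : l.getD j d = d := by
  rw [List.getD_eq_getElem?_getD, List.getElem?_eq_none_iff.mpr hj]
  rfl

end GetD

/-! ### Size and fan-in -/

section Shape

variable (num : K → S) (N : K → ℕ) (t : S) [Monoid S]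

/-- One step of the fold defining `clearAux`. [folklore] -/
theorem clearAux_append_singleton (gs : List (Gate K σ)) (g : Gate K σ) :
    clearAux num N t (gs ++ [g]) =
      ((clearAux num N t gs).1 ++ [gateClear num N t (clearAux num N t gs).2 g],
        (clearAux num N t gs).2 ++ [gateExp N (clearAux num N t gs).2 g]) := by
  simp [clearAux, List.foldl_append]

/-- The cleared gate list and the exponent list have one entry per gate. [folklore] -/
theorem length_clearAux (gs : List (Gate K σ)) :
    (clearAux num N t gs).1.length = gs.length ∧ (clearAux num N t gs).2.length = gs.length := by
  induction gs using List.reverseRecOn with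
  | nil => simp [clearAux]
  | append_singleton gs g ih =>
    rw [clearAux_append_singleton]
    simp [ih.1, ih.2]

/-- Clearing does not change the size. [folklore] -/
@[simp] theorem size_clear (P : ArithCircuit K σ) : (clear num N t P).size = P.size :=
  (length_clearAux num N t P.gates).1

/-- Clearing a gate does not change its fan-in. [folklore] -/
theorem fanIn_gateClear (E : List ℕ) (g : Gate K σ) :
    (gateClear num N t E g).fanIn = g.fanIn := by
  cases g <;> simp [gateClear, Gate.fanIn, Gate.args]

/-- Every gate of the cleared list is a cleared gate. [folklore] -/
theorem mem_clearAux (gs : List (Gate K σ)) :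
    ∀ g' ∈ (clearAux num N t gs).1, ∃ (E : List ℕ) (g : Gate K σ), g ∈ gs ∧
      g' = gateClear num N t E g := by
  induction gs using List.reverseRecOn with
  | nil => simp [clearAux]
  | append_singleton gs g ih =>
    intro g' hg'
    rw [clearAux_append_singleton] at hg'
    simp only [List.mem_append, List.mem_singleton] at hg'
    rcases hg' with h | h
    · obtain ⟨E, g₀, hg₀, rfl⟩ := ih g' h
      exact ⟨E, g₀, List.mem_append_left _ hg₀, rfl⟩
    · exact ⟨_, g, List.mem_append_right _ (List.mem_singleton_self g), h⟩

/-- Clearing preserves fan-in two. [folklore] -/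
theorem isFanInTwo_clear {P : ArithCircuit K σ} (hP : P.IsFanInTwo) :
    (clear num N t P).IsFanInTwo := by
  intro g' hg'
  obtain ⟨E, g, hg, rfl⟩ := mem_clearAux num N t P.gates g' hg'
  rw [fanIn_gateClear]
  exact hP g hg

end Shape

/-! ### Semantics -/

section Semantics

variable [CommSemiring S] [CommSemiring K] (ι : S →+* K) (num : K → S) (N : K → ℕ) (t : S)
  (hnum : ∀ c : K, ι (num c) = ι t ^ N c * c)

/-- A list product of scaled factors: `∏ᵢ (C (x ^ mᵢ) * aᵢ) = C (x ^ Σ mᵢ) * ∏ᵢ aᵢ`. [folklore] -/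
theorem prod_map_C_pow_mul {α : Type*} (x : K) (m : α → ℕ) (a : α → MvPolynomial σ K)
    (l : List α) :
    (l.map fun i => C (x ^ m i) * a i).prod = C (x ^ (l.map m).sum) * (l.map a).prod := by
  induction l with
  | nil => simp
  | cons i l ih =>
    simp only [List.map_cons, List.prod_cons, List.sum_cons, ih, pow_add, C_mul]
    ring

include hnum in
/-- Semantics of a cleared operand: against a value list whose `ι`-image is the scaled original
value list, it evaluates (after `ι`) to `t ^ (opExp u)` times the original value. [folklore] -/
theorem map_eval_opClear {vals' : List (MvPolynomial σ S)} {vals : List (MvPolynomial σ K)}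
    {E : List ℕ}
    (hinv : ∀ j, MvPolynomial.map ι (vals'.getD j 0) = C (ι t ^ E.getD j 0) * vals.getD j 0)
    (u : Operand K σ) :
    MvPolynomial.map ι ((opClear num u).eval vals') = C (ι t ^ opExp N E u) * u.eval vals := by
  cases u with
  | var i => simp [opClear, opExp, Operand.eval]
  | const c => simp [opClear, opExp, Operand.eval, hnum c, C_mul]
  | gate j => simpa [opClear, opExp, Operand.eval] using hinv j

include hnum in
/-- Semantics of a cleared gate: it evaluates (after `ι`) to `t ^ (gateExp g)` times the original
value — products multiply the scalings, weighted sums are brought to the common exponent by the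
powers of `t` put into the coefficients. [folklore] -/
theorem map_eval_gateClear {vals' : List (MvPolynomial σ S)} {vals : List (MvPolynomial σ K)}
    {E : List ℕ}
    (hinv : ∀ j, MvPolynomial.map ι (vals'.getD j 0) = C (ι t ^ E.getD j 0) * vals.getD j 0)
    (g : Gate K σ) :
    MvPolynomial.map ι ((gateClear num N t E g).eval vals') =
      C (ι t ^ gateExp N E g) * g.eval vals := by
  cases g with
  | sum args =>
    simp only [gateClear, gateExp, Gate.eval, List.map_map, map_list_sum]
    set M := (args.map fun a => N a.1 + opExp N E a.2).sum with hM
    have hle : ∀ a ∈ args, N a.1 + opExp N E a.2 ≤ M := fun a ha =>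
      List.le_sum_of_mem (List.mem_map.2 ⟨a, ha, rfl⟩)
    have hterm : ∀ a ∈ args,
        (⇑(MvPolynomial.map ι) ∘ (fun a : S × Operand S σ => a.1 • a.2.eval vals') ∘
          (fun a : K × Operand K σ =>
            (t ^ (M - (N a.1 + opExp N E a.2)) * num a.1, opClear num a.2))) a =
        C (ι t ^ M) * (a.1 • a.2.eval vals) := by
      intro a ha
      simp only [Function.comp_apply, smul_eq_C_mul, map_mul, map_C, map_pow,
        map_eval_opClear ι num N t hnum hinv, hnum a.1]
      have hsplit : M = (M - (N a.1 + opExp N E a.2)) + N a.1 + opExp N E a.2 := by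
        have := hle a ha; omega
      conv_rhs => rw [hsplit]
      simp only [pow_add]
      ring
    rw [List.map_congr_left hterm, List.sum_map_mul_left]
  | prod args =>
    simp only [gateClear, gateExp, Gate.eval, List.map_map, map_list_prod]
    have hterm : ∀ a ∈ args,
        (MvPolynomial.map ι ∘ (fun u : Operand S σ => u.eval vals') ∘ opClear num) a =
          C (ι t ^ opExp N E a) * a.eval vals := fun a _ => by
      simp only [Function.comp_apply, map_eval_opClear ι num N t hnum hinv]
    rw [List.map_congr_left hterm, prod_map_C_pow_mul]

include hnum in
/-- The invariant of the fold: the value list of the cleared gates is, after `ι`, the original value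
list scaled entrywise by `t ^ (recorded exponent)` (stated with `getD`, junk entries `0 = t^0 · 0`).
[folklore] -/
theorem map_gateValues_clearAux (gs : List (Gate K σ)) :
    ∀ j, MvPolynomial.map ι ((gateValues (clearAux num N t gs).1).getD j 0) =
      C (ι t ^ (clearAux num N t gs).2.getD j 0) * (gateValues gs).getD j 0 := by
  induction gs using List.reverseRecOn with
  | nil => intro j; simp [clearAux, gateValues]
  | append_singleton gs g ih =>
    intro j
    have hlen := length_clearAux num N t gs
    have hv' : (gateValues (clearAux num N t gs).1).length = gs.length := by
      rw [gateValues_length, hlen.1]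
    have hv : (gateValues gs).length = gs.length := gateValues_length gs
    rw [clearAux_append_singleton, gateValues_append_singleton, gateValues_append_singleton]
    rcases Nat.lt_trichotomy j gs.length with hj | hj | hj
    · rw [getD_concat_of_lt _ _ _ (by rw [hv']; exact hj),
        getD_concat_of_lt _ _ _ (by rw [hlen.2]; exact hj),
        getD_concat_of_lt _ _ _ (by rw [hv]; exact hj)]
      exact ih j
    · subst hj
      rw [getD_concat_of_eq _ _ _ hv'.symm, getD_concat_of_eq _ _ _ hlen.2.symm,
        getD_concat_of_eq _ _ _ hv.symm]
      exact map_eval_gateClear ι num N t hnum ih g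
    · rw [getD_of_length_le _ _ (by simp [hv']; omega),
        getD_of_length_le _ _ (by simp [hlen.2]; omega),
        getD_of_length_le _ _ (by simp [hv]; omega)]
      simp

include hnum in
/-- **Denominator clearing, semantics**: `clear P` computes, after `ι`, the polynomial
`t ^ (clearExp P) · P.eval`. [folklore] -/
theorem map_eval_clear (P : ArithCircuit K σ) :
    MvPolynomial.map ι (clear num N t P).eval = C (ι t ^ clearExp num N t P) * P.eval :=
  map_eval_opClear ι num N t hnum (map_gateValues_clearAux ι num N t hnum P.gates) P.output

end Semantics

/-! ### The complexity statement -/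

/-- **Clearing denominators costs nothing up to a scalar.** If `ι : S →+* K` is injective and every
`c ∈ K` satisfies `ι s = ι t ^ n * c` for some `n` and `s ∈ S`, then for every `f ∈ S[X]` there is
an exponent `M` with `L_S(t ^ M · f) ≤ L_K(f ⊗_S K)`: clear the denominators of an optimal
`K`-circuit for `f ⊗ K`. [folklore] -/
theorem exists_complexity_C_pow_mul_le [CommSemiring S] [CommSemiring K] (ι : S →+* K)
    (hι : Function.Injective ι) (t : S) (hden : ∀ c : K, ∃ (n : ℕ) (s : S), ι s = ι t ^ n * c)
    (f : MvPolynomial σ S) :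
    ∃ M : ℕ, complexity (C (t ^ M) * f) ≤ complexity (MvPolynomial.map ι f) := by
  choose N num hnum using hden
  obtain ⟨P, hP2, hPf, hsize⟩ := exists_computes_size_eq_complexity (MvPolynomial.map ι f)
  refine ⟨clearExp num N t P, ?_⟩
  have hcomp : (clear num N t P).Computes (C (t ^ clearExp num N t P) * f) := by
    unfold ArithCircuit.Computes at hPf ⊢
    apply MvPolynomial.map_injective ι hι
    rw [map_eval_clear ι num N t hnum, hPf, map_mul, map_C, map_pow ι t]
  calc complexity (C (t ^ clearExp num N t P) * f) ≤ (clear num N t P).size :=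
        complexity_le_size (isFanInTwo_clear num N t hP2) hcomp
    _ = P.size := size_clear num N t P
    _ = complexity (MvPolynomial.map ι f) := hsize

end Clearing

end Summit.ValiantsHypothesis.ValiantsHypothesis.Theorems.TwoAdicLadder.TwoIntegralNormalisation

end
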